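import Summits.BirchSwinnertonDyer.BirchSwinnertonDyer.Theses.UniversalToricDescent
import Summits.BirchSwinnertonDyer.BirchSwinnertonDyer.Theorems.EisensteinPrimesHidaLimitFittingBoundConverse
import HarnessLib

/-!
# NODE (D-0171) on crux stmt-BirchSwinnertonDyer-24207 `UniversalToricDescent.RationalSplitIMCInclusionAtThree`
# — line `twisted-selfdual-square` (crux-ideate standing cover `cruxidea-stmt-BirchSwinnertonDyer-24207-1`, gen 24, 2026-08-31)

KIND: IMPLIED-BY (door, child of g14's leaf (SQ) `SquareCharGeneratorAtThree`), 0 sorry, no new axiom, no named fact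
consumed, `no_new_routes`.  Kernel theorems (checked):
* `charIdeal_eq_span_sq_of_even_lengthAt` — over any UFD: if every height-one local length of a module is EVEN, its
  characteristic ideal is `(g²)` (the algebraic shadow of Howard's `X_tors ∼ N ⊕ N`);
* `squareOverLambda_of_evenLengths : EvenLocalLengthsAtThree → SquareCharIdealOverLambdaAtThree`;
* `squareCharGenerator_of_squareOverLambda : SquareCharIdealOverLambdaAtThree → SquareCharGeneratorAtThree`
  (g14's (SQ) VERBATIM, with the square root ALREADY IN `Λ = ℤ₃⟦T⟧`, not only in `R₀⟦T⟧`);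
* `rationalSplitIMCInclusionAtThree_of_twistedSelfDuality :
    EvenLocalLengthsAtThree → SquareRootLFunctionAtThree → CommonFactorOnRigidRowsAtThree
      → RationalInclusionOffRigidRowsAtThree → crux`  (concludes the crux BY NAME; g14's door A with its (SQ) hypothesis
  DISCHARGED down to the new leaf (ELL)).

THE MOVE («τ-twisted self-duality of (∅,0)», technique class: arithmetic duality / generalised Cassels–Tate pairing —
NOT Euler/Kolyvagin systems, NOT reciprocity laws, NOT congruences, NOT p-adic Hodge theory at 3).
g14 isolated the leaf (SQ) «`Ch_Λ(X_(∅,0))·R₀⟦T⟧` is a square» and tagged it IDEA-NEEDED: «in the ordinary case it follows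
from Howard's `X_tors ∼ M ⊕ M` and the rank-one Λ-adic class — at additive 3 the compact Selmer limit vanishes».  The
observation of this node is that the EVENNESS half of Howard's theorem never used the class.  Howard's self-duality
hypothesis H.4 (Compositio 140 (2004) §2.3; corpus `paper:arxiv-1202.6340` p.7) is NOT «𝓕_v = 𝓕_v^⊥ at each place v»
but the τ-TWISTED form: a perfect pairing `T × Tw(T) → R(1)`, `(s,t) = e(s, t^τ)`, and «𝓕 is its own exact orthogonal
complement under `⟨ , ⟩_v : H¹(K_v,T) × H¹(K_v̄,T) → R`», i.e. the complement of `𝓕_v` is taken IN `H¹(K_v̄, T)`.  For the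
relaxed/strict structure (∅ at 𝔭, 0 at 𝔭′) this holds ON THE NOSE: the complement of `H¹(K_𝔭,T)` (everything) is
`0 = 𝓕_𝔭′`, and the complement of `𝓕_𝔭′ = 0` is everything `= 𝓕_𝔭`.  (Equivalently — the Shapiro form — on the rank-4
family `W = Ind_K^ℚ(T ⊗ ψ)`, which is symplectically self-dual ON THE NOSE because `ψ^c = ψ⁻¹` and `T|_K ⊗ ψ` is
conjugate-symplectic, the structure (∅,0) is the LAGRANGIAN Greenberg datum `W_𝔭 ⊕ 0 ⊂ W|_{G_ℚ₃} = W_𝔭 ⊕ W_𝔭′`.)  The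
pairing `(s,t) = e(s,t^τ)` on `T_𝔮 := T₃E ⊗ S_𝔮(ψ_𝔮)` is `G_K`-equivariant in Howard's sense exactly because
`ψ_𝔮·ψ_𝔮^τ = 1` (anticyclotomic) — his own Remark 2.3.2.  Hence, at every height-one specialisation `𝔮 = (g + 3^m)`,
`(T^m + 3)` of `Λ`, Howard's Theorem 2.4.2 (a generalised Cassels–Tate pairing à la Flach, alternating; corpus p.8–9,
proof uses H.1, H.3, H.4 and the identification lemma only) gives `H¹_(∅,0)(K, T_𝔮/3^k) ≅ (S_𝔮/3^k)^ε ⊕ M_k ⊕ M_k` for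
all `k`, so `H¹_(∅,0)(K, A_𝔮)_{/div} ≅ M_𝔮 ⊕ M_𝔮`; and the proof of Howard's Theorem 3.2.10(b) (corpus p.18: control at
`𝔮 → 𝔭` with kernels/cokernels bounded in `m`, then «an elementary argument shows that for a given e, {i | e_i = e} has
an even number of elements») — which invokes NO Kolyvagin class (the class enters only parts (a),(c)) — yields
`X_(∅,0),Λ-tors ∼ N ⊕ N`, hence every height-one local length of `X_(∅,0)` is EVEN (piece (ELL) below), hence
`Ch_Λ(X_(∅,0)) = (F₁²)` with `F₁ ∈ Λ` (kernel `charIdeal_eq_span_sq_of_even_lengthAt`, `Λ` a UFD).  Nothing at the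
additive prime 3 is used beyond `E(K_𝔭′)[3] = 0` (cartesian-ness of the strict condition; automatic on the 1558+205
supercuspidal rows, where `ρ̄|G_ℚ₃` is irreducible) and finiteness of `E(K_∞,𝔭′)[3^∞]` (control); no ordinary
filtration, no universal norms, no reciprocity law, no admissible prime: the barriers TraceZero / B1 / NoAdmissiblePrimes /
StringentKolyvaginCaps do not quantify over duality statements.  WHY NOVEL (lineage g0–g23, 25 cards): first use on 24207 of
the τ-twisted (Shapiro–Lagrangian) self-duality of the asymmetric pair (∅,0)/(0,∅) — every earlier generation treated
(∅,0) as non-self-dual («dual structure is (0,∅) = τ(∅,0)», g14; PT 4-term sequences, g18) and therefore reserved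
M ⊕ M for the ordinary world; here the class-free half of Howard 2004 is separated from the class-bearing half and shown to
apply verbatim at additive supercuspidal 3.

PIECES AND TAGS (evidence in `Ideas/twisted-selfdual-square.md`):
* `EvenLocalLengthsAtThree` (ELL) — **WEAKER than the crux (a consequence of the two-sided BDP main conjecture; decided
  in every ordinary / a_p = 0 case by BCK 2021 / Castella–Wan, where the crux's analogue is a theorem and 24207 is not) ·
  leaf ATTACKABLE** by the 4-stub line S1 (τ-twisted self-orthogonality of (∅,0): PROVED in the card, three lines) →
  S2 (Howard Thm 2.4.2 for `(T_𝔮, (∅,0))`: hypotheses H.0–H.4 checked in the card; H.5(b) — G_ℚ-stability of the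
  residual structure — FAILS for (∅,0) but is NOT used in §2.4: the proof of 2.4.2 (corpus p.8) invokes H.4 and «Lemma (H.5
  application)», which is the arXiv LABEL of Lemma 2.3.3 (cartesian identifications `H¹_𝓕(K,T/𝔪ⁱ) ≅ H¹_𝓕(K,T)[𝔪ⁱ]`,
  hypotheses H.1 + H.3 only — confirmed by its uses on p.11); genuine H.5 uses are the τ-eigenspaces at Kolyvagin primes
  (p.10, §2.6), never needed here; fallback anyway: Flach's theorem over ℚ on `Ind T_𝔮` with the Lagrangian condition) →
  S3 (control for (∅,0) at
  `𝔮 = (g+3^m)`, bounded in `m`) → S4 (Howard's elementary pairing-of-exponents argument).  INSTRUMENTABLE: parity of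
  `λ(X_(∅,0))`, of `μ`, and of `v₃(#Sel_(∅,0)(K,E[3^∞]))` on the three smallest O6 rows (ask I-g24-1; = g14's F1 read as a
  test of (ELL) rather than of the IMC).
* `SquareCharIdealOverLambdaAtThree` (SQΛ) — **WEAKER · consequence of (ELL) by kernel** (pure algebra, proved here).
* `SquareCharGeneratorAtThree` (SQ, g14 verbatim) — **now WEAKER·ATTACKABLE (was UNDECIDED·IDEA-NEEDED in g14)**.
* `SquareRootLFunctionAtThree` (AN, g14 verbatim) — **WEAKER (true for the BDP function) · ATTACKABLE** (unchanged).
* `CommonFactorOnRigidRowsAtThree` (ONE, g14 verbatim) — **UNDECIDED · IDEA-NEEDED** (unchanged; the engines E1–E3 of g14).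
* `RationalInclusionOffRigidRowsAtThree` (RES, g14 verbatim) — **RESIDUAL = the crux off rigid rows · BARRIER-tagged as the
  crux** (TraceZero, B1, NoAdmissiblePrimes) (unchanged).
INSTRUMENT DATA: none run (kit 0).  HONEST STATUS: nothing here proves BSD for any curve; (ELL) is a referee-grade,
class-free algebraic statement whose four stubs are each in print for the ordinary structure and transfer verbatim except
for the two checks named in S2/S3; (ONE) and the residual remain research.
-/

set_option autoImplicit false
set_option linter.dupNamespace false

noncomputable section

open scoped Classical

namespace Summit.BirchSwinnertonDyer.BirchSwinnertonDyer.Cruxes.RationalSplitIMCInclusionAtThree.TwistedSelfDualSquare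

/-! ## §A  Ring lemmas -/

/-- **Howard-parity ⟹ square (any UFD).**  If every height-one local length of `M` is even, the characteristic ideal
`char(M) = ∏_{ht 𝔭 = 1} 𝔭^{length M_𝔭}` is generated by a square: height-one primes of a UFD are principal
(`UniqueFactorizationMonoid.isPrincipal_of_height_eq_one`), `(g)^{2m} = ((g^m)²)`, and squares of principal ideals are
closed under products (the junk value `1 = ⊤ = (1²)` of an infinite `finprod` included). -/
theorem charIdeal_eq_span_sq_of_even_lengthAt {R : Type*} [CommRing R] [IsDomain R] [UniqueFactorizationMonoid R]
    (M : Type*) [AddCommGroup M] [Module R M]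
    (h : ∀ 𝔭 : PrimeSpectrum R, 𝔭.asIdeal.height = 1 →
      Even (Literature.NumberTheory.EllipticCurves.Module.lengthAt R M 𝔭).toNat) :
    ∃ g : R, Literature.NumberTheory.EllipticCurves.Module.charIdeal R M = Ideal.span {g ^ 2} := by
  unfold Literature.NumberTheory.EllipticCurves.Module.charIdeal
  refine finprod_mem_induction (fun I : Ideal R => ∃ g : R, I = Ideal.span {g ^ 2}) ⟨1, by simp⟩ ?_ ?_
  · rintro I J ⟨a, rfl⟩ ⟨b, rfl⟩
    exact ⟨a * b, by rw [Ideal.span_singleton_mul_span_singleton, mul_pow]⟩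
  · intro 𝔭 h𝔭
    obtain ⟨m, hm⟩ := h 𝔭 h𝔭
    obtain ⟨g, hg⟩ := UniqueFactorizationMonoid.isPrincipal_of_height_eq_one (p := 𝔭.asIdeal) h𝔭
    have hg' : 𝔭.asIdeal = Ideal.span {g} := hg
    refine ⟨g ^ m, ?_⟩
    rw [hm, hg', Ideal.span_singleton_pow, ← two_mul, pow_mul']

/-- Extension of scalars carries a square generator to a square generator. -/
theorem map_span_sq {R S : Type*} [CommRing R] [CommRing S] (φ : R →+* S) (g : R) :
    (Ideal.span {g ^ 2}).map φ = Ideal.span {(φ g) ^ 2} := by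
  rw [Ideal.map_span, Set.image_singleton, map_pow]

/-! ### g14's ring lemmas (restated with proofs; crux workfiles are not importable) -/

theorem dvd_of_irreducible_of_common_nonunit_factor {R : Type*} [CommMonoid R] {F G P : R}
    (hF : Irreducible F) (hP : ¬ IsUnit P) (hPF : P ∣ F) (hPG : P ∣ G) : F ∣ G := by
  obtain ⟨Q, hQ⟩ := hPF
  rcases hF.isUnit_or_isUnit hQ with hPu | hQu
  · exact absurd hPu hP
  · obtain ⟨v, hv⟩ := hQu
    have hFP : F ∣ P := ⟨(↑v⁻¹ : R), by rw [hQ, ← hv, mul_assoc, Units.mul_inv, mul_one]⟩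
    exact hFP.trans hPG

/-- **Door A algebra (Kolyvagin direction, no degree count).** `I = (F₁²)`, `L = u·c^b·L₁²`, `F₁ ∣ L₁` ⟹ `L ∈ I`. -/
theorem mem_span_sq_of_dvd {R : Type*} [CommRing R] {I : Ideal R} {c L F₁ L₁ u : R} {b : ℕ}
    (hI : I = Ideal.span {F₁ ^ 2}) (hL : L = u * c ^ b * L₁ ^ 2) (hdvd : F₁ ∣ L₁) :
    ∃ k : ℕ, c ^ k * L ∈ I := by
  refine ⟨0, ?_⟩
  rw [pow_zero, one_mul, hI, Ideal.mem_span_singleton, hL]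
  exact Dvd.dvd.mul_left (pow_dvd_pow_of_dvd hdvd 2) _

/-! ## §B  The pieces, under 24207's binders (verbatim prefix of the crux + `X` torsion, as in g0/g14) -/

/-- **(ELL) [WEAKER than the crux · leaf ATTACKABLE — the new leaf]** every height-one local length of the `Λ`-module
`X_(∅,0)` is EVEN (Howard-parity: `X_(∅,0),Λ-tors ∼ N ⊕ N`, from the τ-twisted self-duality of (∅,0), Howard 2004
Thm 2.4.2 at the specialisations `𝔮 = (g + 3^m)`, `(T^m + 3)`, control, and the pairing-of-exponents argument of the
proof of his Thm 3.2.10(b) — no Kolyvagin class). -/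
def EvenLocalLengthsAtThree : Prop :=
  ∀ (W : WeierstrassCurve ℚ) [W.IsElliptic] [W.IsGloballyMinimal] (N : ℕ) [NeZero N] (K : Type) [Field K] [NumberField K] (Dt : Literature.NumberTheory.EllipticCurves.ModularForms.ModularParametrizationData W N), Summit.BirchSwinnertonDyer.Rank1Residual.Additive.ClassO6 W 3 → W.HasSurjectiveModNGaloisRep 3 → W.analyticRank = 1 → W.conductorNorm ℤ = N → Literature.NumberTheory.EllipticCurves.IsImaginaryQuadratic K → Literature.NumberTheory.EllipticCurves.SatisfiesHeegnerHypothesis N K → ∀ (κ : Literature.NumberTheory.EllipticCurves.ZpExtension K 3), κ.IsAnticyclotomic → ∀ (γ : Field.absoluteGaloisGroup K) [Fact (κ.IsTopGenerator γ)] (𝔭 : IsDedekindDomain.HeightOneSpectrum (NumberField.RingOfIntegers K)), ((3 : ℕ) : NumberField.RingOfIntegers K) ∈ 𝔭.asIdeal → 𝔭.asIdeal.ramificationIdx (NumberField.RingOfIntegers ℚ) = 1 → 𝔭.asIdeal.inertiaDeg (NumberField.RingOfIntegers ℚ) = 1 → ∀ (𝔭' : IsDedekindDomain.HeightOneSpectrum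 (NumberField.RingOfIntegers K)), ((3 : ℕ) : NumberField.RingOfIntegers K) ∈ 𝔭'.asIdeal → 𝔭' ≠ 𝔭 → ∀ (ι' : PadicAlgCl 3 ≃+* ℂ), Summit.BirchSwinnertonDyer.BirchSwinnertonDyer.Theorems.SchneiderFree.BranchInducesPrime 3 ι' 𝔭 → ∀ (ΩK : ℂ) (Ωp : ℂ_[3]) (L : Literature.NumberTheory.EllipticCurves.UnrSeries 3), ΩK ≠ 0 → Ωp ≠ 0 → Literature.NumberTheory.EllipticCurves.IsBDPLFunction ι' 𝔭 κ γ Dt.f ΩK Ωp L → Module.IsTorsion (Literature.NumberTheory.EllipticCurves.IwasawaAlgebra 3) (Summit.BirchSwinnertonDyer.Rank1Residual.X11b.AcSelmer.XAc (W.baseChange K) 3 κ 𝔭' ∅ γ) →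
    ∀ 𝔮 : PrimeSpectrum (Literature.NumberTheory.EllipticCurves.IwasawaAlgebra 3), 𝔮.asIdeal.height = 1 →
      Even (Literature.NumberTheory.EllipticCurves.Module.lengthAt (Literature.NumberTheory.EllipticCurves.IwasawaAlgebra 3) (Summit.BirchSwinnertonDyer.Rank1Residual.X11b.AcSelmer.XAc (W.baseChange K) 3 κ 𝔭' ∅ γ) 𝔮).toNat

/-- **(SQΛ) [WEAKER · consequence of (ELL) by `squareOverLambda_of_evenLengths`]** the characteristic ideal of `X_(∅,0)`
is generated by a square ALREADY OVER `Λ = ℤ₃⟦T⟧`: `Ch_Λ(X_(∅,0)) = (g²)`. -/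
def SquareCharIdealOverLambdaAtThree : Prop :=
  ∀ (W : WeierstrassCurve ℚ) [W.IsElliptic] [W.IsGloballyMinimal] (N : ℕ) [NeZero N] (K : Type) [Field K] [NumberField K] (Dt : Literature.NumberTheory.EllipticCurves.ModularForms.ModularParametrizationData W N), Summit.BirchSwinnertonDyer.Rank1Residual.Additive.ClassO6 W 3 → W.HasSurjectiveModNGaloisRep 3 → W.analyticRank = 1 → W.conductorNorm ℤ = N → Literature.NumberTheory.EllipticCurves.IsImaginaryQuadratic K → Literature.NumberTheory.EllipticCurves.SatisfiesHeegnerHypothesis N K → ∀ (κ : Literature.NumberTheory.EllipticCurves.ZpExtension K 3), κ.IsAnticyclotomic → ∀ (γ : Field.absoluteGaloisGroup K) [Fact (κ.IsTopGenerator γ)] (𝔭 : IsDedekindDomain.HeightOneSpectrum (NumberField.RingOfIntegers K)), ((3 : ℕ) : NumberField.RingOfIntegers K) ∈ 𝔭.asIdeal → 𝔭.asIdeal.ramificationIdx (NumberField.RingOfIntegers ℚ) = 1 → 𝔭.asIdeal.inertiaDeg (NumberField.RingOfIntegers ℚ) = 1 → ∀ (𝔭' : IsDedekindDomain.HeightOneSpectrum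 (NumberField.RingOfIntegers K)), ((3 : ℕ) : NumberField.RingOfIntegers K) ∈ 𝔭'.asIdeal → 𝔭' ≠ 𝔭 → ∀ (ι' : PadicAlgCl 3 ≃+* ℂ), Summit.BirchSwinnertonDyer.BirchSwinnertonDyer.Theorems.SchneiderFree.BranchInducesPrime 3 ι' 𝔭 → ∀ (ΩK : ℂ) (Ωp : ℂ_[3]) (L : Literature.NumberTheory.EllipticCurves.UnrSeries 3), ΩK ≠ 0 → Ωp ≠ 0 → Literature.NumberTheory.EllipticCurves.IsBDPLFunction ι' 𝔭 κ γ Dt.f ΩK Ωp L → Module.IsTorsion (Literature.NumberTheory.EllipticCurves.IwasawaAlgebra 3) (Summit.BirchSwinnertonDyer.Rank1Residual.X11b.AcSelmer.XAc (W.baseChange K) 3 κ 𝔭' ∅ γ) →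
    ∃ g : Literature.NumberTheory.EllipticCurves.IwasawaAlgebra 3, (Summit.BirchSwinnertonDyer.Rank1Residual.X11b.AcSelmer.XAc.charIdeal (W.baseChange K) 3 κ 𝔭' ∅ γ) = Ideal.span {g ^ 2}

/-- **(SQ) — g14's `EisensteinOrbitAmplification.SquareCharGeneratorAtThree` VERBATIM [now WEAKER · ATTACKABLE]**
`Ch_Λ(X_(∅,0))·R₀⟦T⟧ = (F₁²)`. -/
def SquareCharGeneratorAtThree : Prop :=
  ∀ (W : WeierstrassCurve ℚ) [W.IsElliptic] [W.IsGloballyMinimal] (N : ℕ) [NeZero N] (K : Type) [Field K] [NumberField K] (Dt : Literature.NumberTheory.EllipticCurves.ModularForms.ModularParametrizationData W N), Summit.BirchSwinnertonDyer.Rank1Residual.Additive.ClassO6 W 3 → W.HasSurjectiveModNGaloisRep 3 → W.analyticRank = 1 → W.conductorNorm ℤ = N → Literature.NumberTheory.EllipticCurves.IsImaginaryQuadratic K → Literature.NumberTheory.EllipticCurves.SatisfiesHeegnerHypothesis N K → ∀ (κ : Literature.NumberTheory.EllipticCurves.ZpExtension K 3), κ.IsAnticyclotomic → ∀ (γ :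 Field.absoluteGaloisGroup K) [Fact (κ.IsTopGenerator γ)] (𝔭 : IsDedekindDomain.HeightOneSpectrum (NumberField.RingOfIntegers K)), ((3 : ℕ) : NumberField.RingOfIntegers K) ∈ 𝔭.asIdeal → 𝔭.asIdeal.ramificationIdx (NumberField.RingOfIntegers ℚ) = 1 → 𝔭.asIdeal.inertiaDeg (NumberField.RingOfIntegers ℚ) = 1 → ∀ (𝔭' : IsDedekindDomain.HeightOneSpectrum (NumberField.RingOfIntegers K)), ((3 : ℕ) : NumberField.RingOfIntegers K) ∈ 𝔭'.asIdeal → 𝔭' ≠ 𝔭 → ∀ (ι' : PadicAlgCl 3 ≃+* ℂ), Summit.BirchSwinnertonDyer.BirchSwinnertonDyer.Theorems.SchneiderFree.BranchInducesPrime 3 ι' 𝔭 → ∀ (ΩK : ℂ) (Ωp : ℂ_[3]) (L : Literature.NumberTheory.EllipticCurves.UnrSeries 3), ΩK ≠ 0 → Ωp ≠ 0 → Literature.NumberTheory.EllipticCurves.IsBDPLFunction ι' 𝔭 κ γ Dt.f ΩK Ωp L → Module.IsTorsion (Literature.NumberTheory.EllipticCurves.IwasawaAlgebra 3) (Summit.BirchSwinnertonDyer.Rank1Residual.X11b.AcSelmer.XAc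 (W.baseChange K) 3 κ 𝔭' ∅ γ) →
    ∃ F₁ : Literature.NumberTheory.EllipticCurves.UnrSeries 3,
      (Summit.BirchSwinnertonDyer.Rank1Residual.X11b.AcSelmer.XAc.charIdeal (W.baseChange K) 3 κ 𝔭' ∅ γ).map (PowerSeries.map (Summit.BirchSwinnertonDyer.Rank1Residual.X11b.Halves.toUnr 3)) = Ideal.span {F₁ ^ 2}

/-- **(AN) [WEAKER — true for the BDP function · leaf ATTACKABLE after a definition request]** the analytic side is a square up
to a unit and a power of 3: `L = u·3^b·L₁²` in `R₀⟦T⟧`. -/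
def SquareRootLFunctionAtThree : Prop :=
  ∀ (W : WeierstrassCurve ℚ) [W.IsElliptic] [W.IsGloballyMinimal] (N : ℕ) [NeZero N] (K : Type) [Field K] [NumberField K] (Dt : Literature.NumberTheory.EllipticCurves.ModularForms.ModularParametrizationData W N), Summit.BirchSwinnertonDyer.Rank1Residual.Additive.ClassO6 W 3 → W.HasSurjectiveModNGaloisRep 3 → W.analyticRank = 1 → W.conductorNorm ℤ = N → Literature.NumberTheory.EllipticCurves.IsImaginaryQuadratic K → Literature.NumberTheory.EllipticCurves.SatisfiesHeegnerHypothesis N K → ∀ (κ : Literature.NumberTheory.EllipticCurves.ZpExtension K 3), κ.IsAnticyclotomic → ∀ (γ : Field.absoluteGaloisGroup K) [Fact (κ.IsTopGenerator γ)] (𝔭 : IsDedekindDomain.HeightOneSpectrum (NumberField.RingOfIntegers K)), ((3 : ℕ) : NumberField.RingOfIntegers K) ∈ 𝔭.asIdeal → 𝔭.asIdeal.ramificationIdx (NumberField.RingOfIntegers ℚ) = 1 → 𝔭.asIdeal.inertiaDeg (NumberField.RingOfIntegers ℚ) = 1 → ∀ (𝔭' : IsDedekindDomain.HeightOneSpectrum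 (NumberField.RingOfIntegers K)), ((3 : ℕ) : NumberField.RingOfIntegers K) ∈ 𝔭'.asIdeal → 𝔭' ≠ 𝔭 → ∀ (ι' : PadicAlgCl 3 ≃+* ℂ), Summit.BirchSwinnertonDyer.BirchSwinnertonDyer.Theorems.SchneiderFree.BranchInducesPrime 3 ι' 𝔭 → ∀ (ΩK : ℂ) (Ωp : ℂ_[3]) (L : Literature.NumberTheory.EllipticCurves.UnrSeries 3), ΩK ≠ 0 → Ωp ≠ 0 → Literature.NumberTheory.EllipticCurves.IsBDPLFunction ι' 𝔭 κ γ Dt.f ΩK Ωp L → Module.IsTorsion (Literature.NumberTheory.EllipticCurves.IwasawaAlgebra 3) (Summit.BirchSwinnertonDyer.Rank1Residual.X11b.AcSelmer.XAc (W.baseChange K) 3 κ 𝔭' ∅ γ) →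
    ∃ (L₁ u : Literature.NumberTheory.EllipticCurves.UnrSeries 3) (b : ℕ), IsUnit u ∧
      L = u * ((3 : ℕ) : Literature.NumberTheory.EllipticCurves.UnrSeries 3) ^ b * L₁ ^ 2

/-- **(ONE) [UNDECIDED · leaf IDEA-NEEDED]** on RIGID rows (the algebraic square root `F₁` or the analytic one `L₁` irreducible in
`R₀⟦T⟧`), `F₁` and `L₁` have a common non-unit factor — one common root in `ℂ₃`, no multiplicity asked. -/
def CommonFactorOnRigidRowsAtThree : Prop :=
  ∀ (W : WeierstrassCurve ℚ) [W.IsElliptic] [W.IsGloballyMinimal] (N : ℕ) [NeZero N] (K : Type) [Field K] [NumberField K] (Dt : Literature.NumberTheory.EllipticCurves.ModularForms.ModularParametrizationData W N), Summit.BirchSwinnertonDyer.Rank1Residual.Additive.ClassO6 W 3 → W.HasSurjectiveModNGaloisRep 3 → W.analyticRank = 1 → W.conductorNorm ℤ = N → Literature.NumberTheory.EllipticCurves.IsImaginaryQuadratic K → Literature.NumberTheory.EllipticCurves.SatisfiesHeegnerHypothesis N K → ∀ (κ : Literature.NumberTheory.EllipticCurves.ZpExtension K 3), κ.IsAnticyclotomic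 → ∀ (γ : Field.absoluteGaloisGroup K) [Fact (κ.IsTopGenerator γ)] (𝔭 : IsDedekindDomain.HeightOneSpectrum (NumberField.RingOfIntegers K)), ((3 : ℕ) : NumberField.RingOfIntegers K) ∈ 𝔭.asIdeal → 𝔭.asIdeal.ramificationIdx (NumberField.RingOfIntegers ℚ) = 1 → 𝔭.asIdeal.inertiaDeg (NumberField.RingOfIntegers ℚ) = 1 → ∀ (𝔭' : IsDedekindDomain.HeightOneSpectrum (NumberField.RingOfIntegers K)), ((3 : ℕ) : NumberField.RingOfIntegers K) ∈ 𝔭'.asIdeal → 𝔭' ≠ 𝔭 → ∀ (ι' : PadicAlgCl 3 ≃+* ℂ), Summit.BirchSwinnertonDyer.BirchSwinnertonDyer.Theorems.SchneiderFree.BranchInducesPrime 3 ι' 𝔭 → ∀ (ΩK : ℂ) (Ωp : ℂ_[3]) (L : Literature.NumberTheory.EllipticCurves.UnrSeries 3), ΩK ≠ 0 → Ωp ≠ 0 → Literature.NumberTheory.EllipticCurves.IsBDPLFunction ι' 𝔭 κ γ Dt.f ΩK Ωp L → Module.IsTorsion (Literature.NumberTheory.EllipticCurves.IwasawaAlgebra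 3) (Summit.BirchSwinnertonDyer.Rank1Residual.X11b.AcSelmer.XAc (W.baseChange K) 3 κ 𝔭' ∅ γ) →
    ∀ (F₁ L₁ u : Literature.NumberTheory.EllipticCurves.UnrSeries 3) (b : ℕ),
      (Summit.BirchSwinnertonDyer.Rank1Residual.X11b.AcSelmer.XAc.charIdeal (W.baseChange K) 3 κ 𝔭' ∅ γ).map (PowerSeries.map (Summit.BirchSwinnertonDyer.Rank1Residual.X11b.Halves.toUnr 3)) = Ideal.span {F₁ ^ 2} →
      IsUnit u → L = u * ((3 : ℕ) : Literature.NumberTheory.EllipticCurves.UnrSeries 3) ^ b * L₁ ^ 2 →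
      (Irreducible F₁ ∨ Irreducible L₁) →
      ∃ P : Literature.NumberTheory.EllipticCurves.UnrSeries 3, ¬ IsUnit P ∧ P ∣ F₁ ∧ P ∣ L₁

/-- **RESIDUAL [= the crux restricted to NON-RIGID rows · tagged as the crux: BARRIER (TraceZero, B1, NoAdmissiblePrimes)]**
on rows where a square generator `F₁` and a square root `L₁` are given but `F₁` is NOT irreducible, the rational inclusion. -/
def RationalInclusionOffRigidRowsAtThree : Prop :=
  ∀ (W : WeierstrassCurve ℚ) [W.IsElliptic] [W.IsGloballyMinimal] (N : ℕ) [NeZero N] (K : Type) [Field K] [NumberField K] (Dt : Literature.NumberTheory.EllipticCurves.ModularForms.ModularParametrizationData W N), Summit.BirchSwinnertonDyer.Rank1Residual.Additive.ClassO6 W 3 → W.HasSurjectiveModNGaloisRep 3 → W.analyticRank = 1 → W.conductorNorm ℤ = N → Literature.NumberTheory.EllipticCurves.IsImaginaryQuadratic K → Literature.NumberTheory.EllipticCurves.SatisfiesHeegnerHypothesis N K → ∀ (κ : Literature.NumberTheory.EllipticCurves.ZpExtension K 3), κ.IsAnticyclotomic → ∀ (γ : Field.absoluteGaloisGroup K)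 [Fact (κ.IsTopGenerator γ)] (𝔭 : IsDedekindDomain.HeightOneSpectrum (NumberField.RingOfIntegers K)), ((3 : ℕ) : NumberField.RingOfIntegers K) ∈ 𝔭.asIdeal → 𝔭.asIdeal.ramificationIdx (NumberField.RingOfIntegers ℚ) = 1 → 𝔭.asIdeal.inertiaDeg (NumberField.RingOfIntegers ℚ) = 1 → ∀ (𝔭' : IsDedekindDomain.HeightOneSpectrum (NumberField.RingOfIntegers K)), ((3 : ℕ) : NumberField.RingOfIntegers K) ∈ 𝔭'.asIdeal → 𝔭' ≠ 𝔭 → ∀ (ι' : PadicAlgCl 3 ≃+* ℂ), Summit.BirchSwinnertonDyer.BirchSwinnertonDyer.Theorems.SchneiderFree.BranchInducesPrime 3 ι' 𝔭 → ∀ (ΩK : ℂ) (Ωp : ℂ_[3]) (L : Literature.NumberTheory.EllipticCurves.UnrSeries 3), ΩK ≠ 0 → Ωp ≠ 0 → Literature.NumberTheory.EllipticCurves.IsBDPLFunction ι' 𝔭 κ γ Dt.f ΩK Ωp L → Module.IsTorsion (Literature.NumberTheory.EllipticCurves.IwasawaAlgebra 3) (Summit.BirchSwinnertonDyer.Rank1Residual.X11b.AcSelmer.XAc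 (W.baseChange K) 3 κ 𝔭' ∅ γ) →
    ∀ (F₁ L₁ u : Literature.NumberTheory.EllipticCurves.UnrSeries 3) (b : ℕ),
      (Summit.BirchSwinnertonDyer.Rank1Residual.X11b.AcSelmer.XAc.charIdeal (W.baseChange K) 3 κ 𝔭' ∅ γ).map (PowerSeries.map (Summit.BirchSwinnertonDyer.Rank1Residual.X11b.Halves.toUnr 3)) = Ideal.span {F₁ ^ 2} →
      IsUnit u → L = u * ((3 : ℕ) : Literature.NumberTheory.EllipticCurves.UnrSeries 3) ^ b * L₁ ^ 2 →
      ¬ Irreducible F₁ →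
      ∃ k : ℕ, ((3 : ℕ) : Literature.NumberTheory.EllipticCurves.UnrSeries 3) ^ k * L ∈
        (Summit.BirchSwinnertonDyer.Rank1Residual.X11b.AcSelmer.XAc.charIdeal (W.baseChange K) 3 κ 𝔭' ∅ γ).map (PowerSeries.map (Summit.BirchSwinnertonDyer.Rank1Residual.X11b.Halves.toUnr 3))

/-! ## §C  Kernels -/

/-- **(ELL) ⟹ (SQΛ)** — `Λ = ℤ₃⟦T⟧` is a UFD (`PowerSeries` over a PID), so `charIdeal_eq_span_sq_of_even_lengthAt` applies. -/
theorem squareOverLambda_of_evenLengths (hELL : EvenLocalLengthsAtThree) : SquareCharIdealOverLambdaAtThree := by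
  intro W _ _ N _ K _ _ Dt hO6 hsurj hr1 hN hK hH κ hκ γ _ 𝔭 h𝔭 he hf 𝔭' h𝔭' hne ι' hι ΩK Ωp L hΩK hΩp hL htor
  unfold Summit.BirchSwinnertonDyer.Rank1Residual.X11b.AcSelmer.XAc.charIdeal
  exact charIdeal_eq_span_sq_of_even_lengthAt _
    (hELL W N K Dt hO6 hsurj hr1 hN hK hH κ hκ γ 𝔭 h𝔭 he hf 𝔭' h𝔭' hne ι' hι ΩK Ωp L hΩK hΩp hL htor)

/-- **(SQΛ) ⟹ (SQ)** — extend scalars along `Λ → R₀⟦T⟧` (`PowerSeries.map toUnr`). -/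
theorem squareCharGenerator_of_squareOverLambda (hSQΛ : SquareCharIdealOverLambdaAtThree) :
    SquareCharGeneratorAtThree := by
  intro W _ _ N _ K _ _ Dt hO6 hsurj hr1 hN hK hH κ hκ γ _ 𝔭 h𝔭 he hf 𝔭' h𝔭' hne ι' hι ΩK Ωp L hΩK hΩp hL htor
  obtain ⟨g, hg⟩ :=
    hSQΛ W N K Dt hO6 hsurj hr1 hN hK hH κ hκ γ 𝔭 h𝔭 he hf 𝔭' h𝔭' hne ι' hι ΩK Ωp L hΩK hΩp hL htor
  exact ⟨(PowerSeries.map (Summit.BirchSwinnertonDyer.Rank1Residual.X11b.Halves.toUnr 3)) g, by rw [hg, map_span_sq]⟩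

/-- **DOOR (kernel-checked, concludes the crux BY NAME).** (ELL) ∧ (AN) ∧ (ONE) ∧ RESIDUAL ⟹ 24207: (ELL) gives (SQ) by the
two kernels above, and then g14's door A runs verbatim — on `F₁`-rigid rows a common non-unit factor and irreducibility of
`F₁` give `F₁ ∣ L₁`, hence `L ∈ (F₁²)` with `k = 0`; off rigid rows the residual; degenerate frame (`X` not torsion,
`Ch = Λ`): `k = 0`. -/
theorem rationalSplitIMCInclusionAtThree_of_twistedSelfDuality
    (hELL : EvenLocalLengthsAtThree) (hAN : SquareRootLFunctionAtThree)
    (hONE : CommonFactorOnRigidRowsAtThree) (hRES : RationalInclusionOffRigidRowsAtThree) :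
    Summit.BirchSwinnertonDyer.BirchSwinnertonDyer.Theses.UniversalToricDescent.RationalSplitIMCInclusionAtThree := by
  have hSQ : SquareCharGeneratorAtThree :=
    squareCharGenerator_of_squareOverLambda (squareOverLambda_of_evenLengths hELL)
  intro W _ _ N _ K _ _ Dt hO6 hsurj hr1 hN hK hH κ hκ γ _ 𝔭 h𝔭 he hf 𝔭' h𝔭' hne ι' hι ΩK Ωp L hΩK hΩp hL
  by_cases htor : Module.IsTorsion (Literature.NumberTheory.EllipticCurves.IwasawaAlgebra 3) (Summit.BirchSwinnertonDyer.Rank1Residual.X11b.AcSelmer.XAc (W.baseChange K) 3 κ 𝔭' ∅ γ)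
  · obtain ⟨F₁, hCh⟩ :=
      hSQ W N K Dt hO6 hsurj hr1 hN hK hH κ hκ γ 𝔭 h𝔭 he hf 𝔭' h𝔭' hne ι' hι ΩK Ωp L hΩK hΩp hL htor
    obtain ⟨L₁, u, b, hu, hLeq⟩ :=
      hAN W N K Dt hO6 hsurj hr1 hN hK hH κ hκ γ 𝔭 h𝔭 he hf 𝔭' h𝔭' hne ι' hι ΩK Ωp L hΩK hΩp hL htor
    by_cases hF₁ : Irreducible F₁
    · obtain ⟨P, hPu, hPF, hPL⟩ :=
        hONE W N K Dt hO6 hsurj hr1 hN hK hH κ hκ γ 𝔭 h𝔭 he hf 𝔭' h𝔭' hne ι' hι ΩK Ωp L hΩK hΩp hL htor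
          F₁ L₁ u b hCh hu hLeq (Or.inl hF₁)
      exact mem_span_sq_of_dvd hCh hLeq (dvd_of_irreducible_of_common_nonunit_factor hF₁ hPu hPF hPL)
    · exact hRES W N K Dt hO6 hsurj hr1 hN hK hH κ hκ γ 𝔭 h𝔭 he hf 𝔭' h𝔭' hne ι' hι ΩK Ωp L hΩK hΩp hL htor
        F₁ L₁ u b hCh hu hLeq hF₁
  · refine ⟨0, ?_⟩
    have htop : Summit.BirchSwinnertonDyer.Rank1Residual.X11b.AcSelmer.XAc.charIdeal (W.baseChange K) 3 κ 𝔭' ∅ γ = ⊤ :=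
      Summit.BirchSwinnertonDyer.BirchSwinnertonDyer.Theorems.charIdeal_eq_top_of_not_isTorsion (p := 3) _ htor
    rw [htop, Ideal.map_top]; exact Submodule.mem_top

end Summit.BirchSwinnertonDyer.BirchSwinnertonDyer.Cruxes.RationalSplitIMCInclusionAtThree.TwistedSelfDualSquare

end
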